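import Literature.NumberTheory.LFunctions.DedekindZetaClassSumCont
import Literature.NumberTheory.LFunctions.RHGeneralizedRHDedekindProofs
import Literature.NumberTheory.LFunctions.DobnerTheorem4Proofs
import Literature.NumberTheory.LFunctions.SelbergClassDirichletProofs
import Mathlib.Analysis.Complex.ReImTopology
import HarnessLib

/-!
# `(s − 1) ζ_K(s)` has finite order (Selberg's axiom (ii) for the Dedekind zeta function) — proofs

Topic `Literature/NumberTheory/LFunctions`, sibling proofs file (D-0014) of `DedekindZetaFiniteOrder.lean`,
whose named fact `Literature.NumberTheory.LFunctions.dedekindZetaCont_finiteOrder K`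
(`‖(s − 1) ζ_K(s)‖ ≤ A exp(‖s‖^B)` off `s = 1`; Kaczorowski, *Axiomatic theory of L-functions: the
Selberg class* (2006), §2.1 axiom (2) with Example 3 "`ζ_K(s)`, the Dedekind zeta function of an
algebraic number field"; Kaczorowski–Perelli 1999, §1) is, with the functional equation
`Literature.NumberTheory.LFunctions.completedDedekindZeta_one_sub`, the last undischarged input of the
conditional assembly `Literature.NumberTheory.LFunctions.exists_selbergDatum_dedekindZetaCont_of`
(`RHGeneralizedRHDedekindProofs.lean`) of the membership of `ζ_K` in the Selberg class. Everything
here is PROVED and no definition is introduced. Main result: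

* `dedekindZetaCont_finiteOrder_of_completedDedekindZeta_one_sub :
    completedDedekindZeta_one_sub → dedekindZetaCont_finiteOrder K`

(with `B = 3`), so that the fact follows from the functional equation alone (whose discharge along
Neukirch VII (5.9)–(5.10) is the business of `DedekindZetaHeckeSymmetry.lean` and its sequel).

## Proof architecture (three regions, as in Titchmarsh's proof of (2.12.3) for `ζ`)

All intermediate bounds have the shape `‖F(s)‖ ≤ A exp(c‖s‖²)` on a set `D`, a shape closed under sums
and products (`growth_add`, `growth_mul`, `growth_sum`, `growth_prod`, `growth_pow`); at the end
`c‖s‖² ≤ ‖s‖³ + c³`.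

1. **Vertical strips** `|Re s| ≤ R` (`growth_sum_classSumEntire`): the explicit class representation of
   `DedekindZetaClassSumCont.lean` (Neukirch, *Algebraic Number Theory*, VII (5.9)–(5.11), through
   Mathlib's `WeakFEPair`), `(s − 1) ζ_K(s) = ∑_C E_C(s)`,
   `E_C(s) = B(s)((s − 1)Λ₀(s/2) + 2ε) − (s − 1)B₀(s)`, `B = c_K⁻¹ w⁻¹ 𝔑(J_C)^s A(s/2)⁻¹`,
   `B₀ = c_K⁻¹ w⁻¹ 𝔑(J_C)^s E₀(s/2)`, with
   * `exists_norm_inv_Gamma_le_of_abs_re_le` — **`1/Γ` on vertical strips**, `‖Γ(u)⁻¹‖ ≤ A exp(c‖u‖²)`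
     for `|Re u| ≤ S`: the tree's uniform lower bound `norm_Gamma_ge_uniform` (`DobnerTheorem4Proofs.lean`;
     reflection and recurrence) for `Im u ≥ 1`, conjugation for `Im u ≤ −1`, compactness of the
     rectangle `|Im u| ≤ 1` (classically Stirling, `1/|Γ(σ+it)| ≍ e^{π|t|/2}|t|^{1/2−σ}`, Titchmarsh §4.42);
   * `weakFEPair_exists_norm_Λ₀_le` — **Mathlib's entire `Λ₀` of any weak FE-pair is bounded on vertical
     strips** (absolute convergence of `∫ t^{z−1} f_modif` at the two abscissae,
     `IsStrongFEPair.hasMellin`; the "bounded in vertical strips" clause of Hecke's theorem).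
2. **`Re s ≥ 2`** (`exists_norm_dedekindZetaCont_le_of_two_le_re`): `‖ζ_K(s)‖ ≤ ∑ a_n n^{-2}` from the
   Dirichlet series (`isDedekindZetaContinuation_dedekindZetaCont_holds`).
3. **`Re s ≤ −1`** (`growth_dedekindZetaCont_of_re_le_neg_one`): for `s ∉ ℤ`,
   `ζ_K(s) = γ_K(s)⁻¹ γ_K(1 − s) ζ_K(1 − s)` by the functional equation
   (`γ_K(s) = |d_K|^{s/2} Γ_ℝ(s)^{r₁} Γ_ℂ(s)^{r₂} ≠ 0` off `ℤ`, `dedekindGammaFactor_ne_zero`), with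
   `‖Γ(w)‖ ≤ Γ(Re w) ≤ exp(‖w‖²)` for `Re w ≥ 1` (`norm_Gamma_le_Gamma_re`, `Real.Gamma_le_rpow_self` of
   `RiemannXiOrderProofs.lean`) and the reflection formula `Γ(z)⁻¹ = Γ(1 − z) sin(πz)/π`
   (`norm_inv_Gamma_le_of_re_nonpos`, Mathlib `Complex.Gamma_mul_Gamma_one_sub`); the integer points
   `s = m ≤ −1` follow by continuity of the entire `∑_C E_C` along `m + i/k`
   (`exists_bound_sub_one_mul_dedekindZetaCont_of_re_le_neg_one`).

## References

* J. Kaczorowski, *Axiomatic theory of `L`-functions: the Selberg class*, in: Analytic Number Theory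
  (C.I.M.E. Cetraro 2002), Lecture Notes in Math. 1891, Springer 2006, §2.1 axiom (2) and Example 3
  (pp. 156–157 = PDF pp. 133–134 of the held copy `book:friedlandernd-analytic-number-theory`).
  [KaczorowskiSelbergClass2006]
* J. Kaczorowski, A. Perelli, *The Selberg class: a survey*, in: Number Theory in Progress, Vol. 2,
  de Gruyter 1999, 953–992, §1. [KaczorowskiPerelli1999]
* J. Neukirch, *Algebraic Number Theory*, Grundlehren 322, Springer 1999, Ch. VII (1.4), (5.9)–(5.11).
  [NeukirchANT1999]
* E. C. Titchmarsh, *The Theory of the Riemann Zeta-Function*, 2nd ed. (1986), §2.12 (proof of (2.12.3)),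
  §4.42. [Titchmarsh1986]
-/

noncomputable section

open scoped NumberField nonZeroDivisors
open NumberField NumberField.InfinitePlace NumberField.Units MeasureTheory Complex Filter Topology Set

namespace Literature.NumberTheory.LFunctions.NumberField

variable {K : Type*} [Field K] [NumberField K]

/-! ## Growth bookkeeping: bounds of the shape `A · exp (c ‖s‖²)` -/

/-- `‖s‖ ≤ 1 + ‖s‖²`. [folklore] -/
theorem norm_le_one_add_norm_sq (s : ℂ) : ‖s‖ ≤ 1 + ‖s‖ ^ 2 := by
  nlinarith [norm_nonneg s, sq_nonneg (‖s‖ - 1)]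

/-- `exp (c ‖s‖) ≤ exp c · exp (c ‖s‖²)` for `c ≥ 0`. [folklore] -/
theorem exp_mul_norm_le {c : ℝ} (hc : 0 ≤ c) (s : ℂ) :
    Real.exp (c * ‖s‖) ≤ Real.exp c * Real.exp (c * ‖s‖ ^ 2) := by
  rw [← Real.exp_add]
  exact Real.exp_le_exp.mpr (by nlinarith [norm_le_one_add_norm_sq s])

/-- Monotonicity of the majorant in `c`. [folklore] -/
theorem exp_mul_norm_sq_le_of_le {c c' : ℝ} (h : c ≤ c') (s : ℂ) :
    Real.exp (c * ‖s‖ ^ 2) ≤ Real.exp (c' * ‖s‖ ^ 2) :=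
  Real.exp_le_exp.mpr (mul_le_mul_of_nonneg_right h (sq_nonneg _))

/-- A polynomial factor is absorbed: `‖s‖ + 1 ≤ exp 1 · exp (‖s‖²)`. [folklore] -/
theorem norm_add_one_le_exp (s : ℂ) : ‖s‖ + 1 ≤ Real.exp 1 * Real.exp (1 * ‖s‖ ^ 2) := by
  have h1 : ‖s‖ + 1 ≤ Real.exp (‖s‖) := by linarith [Real.add_one_le_exp ‖s‖]
  have h2 := exp_mul_norm_le zero_le_one s
  calc ‖s‖ + 1 ≤ Real.exp ‖s‖ := h1
    _ = Real.exp (1 * ‖s‖) := by rw [one_mul]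
    _ ≤ _ := h2

/-! ## `1/Γ` on vertical strips -/

/-- `‖Γ(ū)‖ = ‖Γ(u)‖`. [folklore] -/
theorem norm_Gamma_conj (u : ℂ) : ‖Complex.Gamma (starRingEnd ℂ u)‖ = ‖Complex.Gamma u‖ := by
  rw [Complex.Gamma_conj, Complex.norm_conj]

/-- **`1/Γ` has exponential type on vertical strips**: for `S ≥ 0` there are `A, c ≥ 0` with
`‖Γ(u)⁻¹‖ ≤ A exp(c ‖u‖²)` whenever `|Re u| ≤ S`. For `|Im u| ≥ 1` this is the uniform lower bound
`‖Γ(u)‖ ≥ π e^{-π|Im u|} (S + N + |Im u|)^{-N}` of the tree (`norm_Gamma_ge_uniform`, reflection formula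
and the recurrence), and on the compact rectangle `|Im u| ≤ 1` the entire function `1/Γ` is bounded.
(Classically `1/|Γ(σ+it)| ≍ e^{π|t|/2}|t|^{1/2-σ}`, Stirling; Titchmarsh §4.42.) [folklore] -/
theorem exists_norm_inv_Gamma_le_of_abs_re_le {S : ℝ} (hS : 0 ≤ S) :
    ∃ A c : ℝ, 0 ≤ A ∧ 0 ≤ c ∧ ∀ u : ℂ, |u.re| ≤ S → ‖(Complex.Gamma u)⁻¹‖ ≤ A * Real.exp (c * ‖u‖ ^ 2) := by
  set N : ℕ := ⌈S⌉₊ + 1 with hN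
  -- the compact rectangle `|Re u| ≤ S`, `|Im u| ≤ 1`
  obtain ⟨C₀, hC₀⟩ : ∃ C₀ : ℝ, ∀ u ∈ (Icc (-S) S ×ℂ Icc (-1 : ℝ) 1), ‖(Complex.Gamma u)⁻¹‖ ≤ C₀ :=
    (isCompact_Icc.reProdIm isCompact_Icc).exists_bound_of_continuousOn
      Complex.differentiable_one_div_Gamma.continuous.continuousOn
  have hC₀' : 0 ≤ C₀ := le_trans (norm_nonneg _) (hC₀ 0 ⟨by simp [hS], by simp⟩)
  -- the half-strips `|Im u| ≥ 1`
  set A₁ : ℝ := Real.pi⁻¹ * Real.exp ((N : ℝ) * (S + N)) with hA₁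
  have hA₁0 : 0 ≤ A₁ := by positivity
  have key : ∀ u : ℂ, |u.re| ≤ S → 1 ≤ u.im →
      ‖(Complex.Gamma u)⁻¹‖ ≤ A₁ * Real.exp ((N + Real.pi) * ‖u‖) := by
    intro u hu hτ
    have h := norm_Gamma_ge_uniform hS hu hτ
    rw [← hN] at h
    have hτ0 : 0 < u.im := by linarith
    have hbase : 1 ≤ S + N + u.im := by
      rw [hN]; push_cast; linarith [Nat.le_ceil S]
    have hlow : 0 < Real.pi * Real.exp (-(Real.pi * u.im)) * (S + N + u.im) ^ (-(N : ℝ)) := by positivity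
    have hΓ0 : 0 < ‖Complex.Gamma u‖ := lt_of_lt_of_le hlow h
    rw [norm_inv, inv_le_comm₀ hΓ0 (by positivity)]
    refine le_trans ?_ h
    -- `(A₁ exp((N+π)‖u‖))⁻¹ ≤ π e^{-π Im u} (S+N+Im u)^{-N}`
    have him : u.im ≤ ‖u‖ := le_trans (le_abs_self _) (Complex.abs_im_le_norm u)
    have hpow : (S + N + u.im) ^ (N : ℝ) ≤ Real.exp ((N : ℝ) * (S + N) + N * ‖u‖) := by
      calc (S + N + u.im) ^ (N : ℝ) ≤ Real.exp (S + N + u.im) ^ (N : ℝ) := by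
            refine Real.rpow_le_rpow (by linarith) ?_ (Nat.cast_nonneg _)
            linarith [Real.add_one_le_exp (S + N + u.im)]
        _ = Real.exp ((N : ℝ) * (S + N + u.im)) := by rw [← Real.exp_mul, mul_comm]
        _ ≤ Real.exp ((N : ℝ) * (S + N) + N * ‖u‖) := Real.exp_le_exp.mpr (by nlinarith [Nat.cast_nonneg (α := ℝ) N])
    rw [hA₁]
    have hexp : Real.exp (-(Real.pi * u.im)) = (Real.exp (Real.pi * u.im))⁻¹ := Real.exp_neg _
    rw [Real.rpow_neg (by linarith), hexp]
    have h1 : Real.exp (Real.pi * u.im) ≤ Real.exp (Real.pi * ‖u‖) :=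
      Real.exp_le_exp.mpr (mul_le_mul_of_nonneg_left him Real.pi_pos.le)
    have hNpos : (0 : ℝ) < (S + N + u.im) ^ (N : ℝ) := Real.rpow_pos_of_pos (by linarith) _
    calc (Real.pi⁻¹ * Real.exp ((N : ℝ) * (S + N)) * Real.exp ((N + Real.pi) * ‖u‖))⁻¹
        = Real.pi * ((Real.exp ((N : ℝ) * (S + N)) * Real.exp ((N + Real.pi) * ‖u‖)))⁻¹ := by
          rw [mul_assoc, mul_inv, inv_inv]
      _ = Real.pi * ((Real.exp (Real.pi * ‖u‖))⁻¹ * (Real.exp ((N : ℝ) * (S + N) + N * ‖u‖))⁻¹) := by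
          rw [← Real.exp_add, ← mul_inv, ← Real.exp_add]; congr 2; ring_nf
      _ ≤ Real.pi * ((Real.exp (Real.pi * u.im))⁻¹ * ((S + N + u.im) ^ (N : ℝ))⁻¹) := by
          gcongr
      _ = Real.pi * (Real.exp (Real.pi * u.im))⁻¹ * ((S + N + u.im) ^ (N : ℝ))⁻¹ := by ring
  clear_value A₁
  refine ⟨max C₀ (A₁ * Real.exp (N + Real.pi)), N + Real.pi, le_max_of_le_left hC₀', by positivity,
    fun u hu ↦ ?_⟩
  have hgrow : A₁ * Real.exp ((N + Real.pi) * ‖u‖) ≤ A₁ * Real.exp (N + Real.pi) * Real.exp ((N + Real.pi) * ‖u‖ ^ 2) := by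
    have h := exp_mul_norm_le (c := N + Real.pi) (by positivity) u
    calc A₁ * Real.exp ((N + Real.pi) * ‖u‖)
        ≤ A₁ * (Real.exp (N + Real.pi) * Real.exp ((N + Real.pi) * ‖u‖ ^ 2)) := mul_le_mul_of_nonneg_left h hA₁0
      _ = _ := by ring
  rcases le_or_gt 1 u.im with hτ | hτ
  · calc ‖(Complex.Gamma u)⁻¹‖ ≤ A₁ * Real.exp ((N + Real.pi) * ‖u‖) := key u hu hτ
      _ ≤ A₁ * Real.exp (N + Real.pi) * Real.exp ((N + Real.pi) * ‖u‖ ^ 2) := hgrow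
      _ ≤ max C₀ (A₁ * Real.exp (N + Real.pi)) * Real.exp ((N + Real.pi) * ‖u‖ ^ 2) :=
          mul_le_mul_of_nonneg_right (le_max_right _ _) (Real.exp_pos _).le
  rcases le_or_gt u.im (-1) with hτ' | hτ'
  · -- conjugate
    have hu' : |(starRingEnd ℂ u).re| ≤ S := by simpa using hu
    have hτ'' : 1 ≤ (starRingEnd ℂ u).im := by simp; linarith
    have h := key _ hu' hτ''
    rw [norm_inv, norm_Gamma_conj, Complex.norm_conj, ← norm_inv] at h
    calc ‖(Complex.Gamma u)⁻¹‖ ≤ A₁ * Real.exp ((N + Real.pi) * ‖u‖) := h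
      _ ≤ A₁ * Real.exp (N + Real.pi) * Real.exp ((N + Real.pi) * ‖u‖ ^ 2) := hgrow
      _ ≤ max C₀ (A₁ * Real.exp (N + Real.pi)) * Real.exp ((N + Real.pi) * ‖u‖ ^ 2) :=
          mul_le_mul_of_nonneg_right (le_max_right _ _) (Real.exp_pos _).le
  · -- compact part
    have hmem : u ∈ (Icc (-S) S ×ℂ Icc (-1 : ℝ) 1) := ⟨abs_le.mp hu, ⟨hτ'.le, hτ.le⟩⟩
    calc ‖(Complex.Gamma u)⁻¹‖ ≤ C₀ := hC₀ u hmem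
      _ ≤ max C₀ (A₁ * Real.exp (N + Real.pi)) * 1 := by rw [mul_one]; exact le_max_left _ _
      _ ≤ max C₀ (A₁ * Real.exp (N + Real.pi)) * Real.exp ((N + Real.pi) * ‖u‖ ^ 2) :=
          mul_le_mul_of_nonneg_left (Real.one_le_exp (by positivity)) (le_max_of_le_left hC₀')

/-! ## `Λ₀` is bounded on vertical strips -/

/-- `t^{x-1} ≤ t^{a-1} + t^{b-1}` for `t > 0` and `a ≤ x ≤ b`. [folklore] -/
theorem rpow_sub_one_le_add {t a b x : ℝ} (ht : 0 < t) (hax : a ≤ x) (hxb : x ≤ b) :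
    t ^ (x - 1) ≤ t ^ (a - 1) + t ^ (b - 1) := by
  rcases le_or_gt 1 t with h1 | h1
  · calc t ^ (x - 1) ≤ t ^ (b - 1) := Real.rpow_le_rpow_of_exponent_le h1 (by linarith)
      _ ≤ t ^ (a - 1) + t ^ (b - 1) := le_add_of_nonneg_left (Real.rpow_nonneg ht.le _)
  · calc t ^ (x - 1) ≤ t ^ (a - 1) := Real.rpow_le_rpow_of_exponent_ge ht h1.le (by linarith)
      _ ≤ t ^ (a - 1) + t ^ (b - 1) := le_add_of_nonneg_right (Real.rpow_nonneg ht.le _)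

/-- **Mathlib's entire `Λ₀` of a weak FE-pair is bounded on every vertical strip** `a ≤ Re z ≤ b`:
`Λ₀ = ∫₀^∞ t^{z-1} f_modif(t) dt` converges absolutely at every abscissa (`IsStrongFEPair.hasMellin` for
`P.toStrongFEPair`), and `|t^{z-1}| = t^{Re z - 1} ≤ t^{a-1} + t^{b-1}`. (This is the standard remark that
Hecke's integral representation gives boundedness in vertical strips; Neukirch VII (1.4), proof.) [folklore] -/
theorem weakFEPair_exists_norm_Λ₀_le (P : WeakFEPair ℂ) (a b : ℝ) :
    ∃ M : ℝ, 0 ≤ M ∧ ∀ z : ℂ, a ≤ z.re → z.re ≤ b → ‖P.Λ₀ z‖ ≤ M := by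
  have hconv : ∀ z : ℂ, IntegrableOn (fun t : ℝ ↦ (t : ℂ) ^ (z - 1) • P.f_modif t) (Ioi 0) := fun z ↦
    (P.isStrongFEPair_toStrongFEPair.hasMellin z).1
  set g : ℝ → ℝ := fun t ↦ (t ^ (a - 1) + t ^ (b - 1)) * ‖P.f_modif t‖ with hg
  have hnorm : ∀ (z : ℂ) (t : ℝ), 0 < t → ‖(t : ℂ) ^ (z - 1) • P.f_modif t‖ = t ^ (z.re - 1) * ‖P.f_modif t‖ := by
    intro z t ht
    rw [norm_smul, Complex.norm_cpow_eq_rpow_re_of_pos ht, Complex.sub_re, Complex.one_re]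
  have hgi : IntegrableOn g (Ioi 0) := by
    have hab : IntegrableOn (fun t : ℝ ↦ ‖(t : ℂ) ^ ((a : ℂ) - 1) • P.f_modif t‖ +
        ‖(t : ℂ) ^ ((b : ℂ) - 1) • P.f_modif t‖) (Ioi 0) := ((hconv a).norm).add ((hconv b).norm)
    refine IntegrableOn.congr_fun hab (fun t (ht : 0 < t) ↦ ?_) measurableSet_Ioi
    simp only [hg]
    rw [hnorm a t ht, hnorm b t ht, Complex.ofReal_re, Complex.ofReal_re]
    ring
  refine ⟨∫ t in Ioi 0, g t, setIntegral_nonneg measurableSet_Ioi (fun t (ht : 0 < t) ↦ ?_), fun z hza hzb ↦ ?_⟩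
  · simp only [hg]
    exact mul_nonneg (add_nonneg (Real.rpow_nonneg ht.le _) (Real.rpow_nonneg ht.le _)) (norm_nonneg _)
  · unfold WeakFEPair.Λ₀ mellin
    calc ‖∫ t : ℝ in Ioi 0, (↑t : ℂ) ^ (z - 1) • P.f_modif t‖
        ≤ ∫ t : ℝ in Ioi 0, ‖(↑t : ℂ) ^ (z - 1) • P.f_modif t‖ := norm_integral_le_integral_norm _
      _ ≤ ∫ t in Ioi 0, g t := by
          refine setIntegral_mono_on (hconv z).norm hgi measurableSet_Ioi fun t (ht : 0 < t) ↦ ?_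
          rw [hnorm z t ht]
          simp only [hg]
          exact mul_le_mul_of_nonneg_right (rpow_sub_one_le_add ht hza hzb) (norm_nonneg _)

/-! ## The algebra of bounds `‖F s‖ ≤ A exp(c ‖s‖²)` on a set `D` -/

/-- Constants. [folklore] -/
theorem growth_const (D : Set ℂ) (v : ℂ) :
    ∃ A c : ℝ, 0 ≤ A ∧ 0 ≤ c ∧ ∀ s ∈ D, ‖(fun _ : ℂ ↦ v) s‖ ≤ A * Real.exp (c * ‖s‖ ^ 2) :=
  ⟨‖v‖, 0, norm_nonneg v, le_rfl, fun s _ ↦ by simp⟩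

/-- Domination. [folklore] -/
theorem growth_of_le {D : Set ℂ} {F G : ℂ → ℂ} (hle : ∀ s ∈ D, ‖F s‖ ≤ ‖G s‖)
    (hG : ∃ A c : ℝ, 0 ≤ A ∧ 0 ≤ c ∧ ∀ s ∈ D, ‖G s‖ ≤ A * Real.exp (c * ‖s‖ ^ 2)) :
    ∃ A c : ℝ, 0 ≤ A ∧ 0 ≤ c ∧ ∀ s ∈ D, ‖F s‖ ≤ A * Real.exp (c * ‖s‖ ^ 2) := by
  obtain ⟨A, c, hA, hc, h⟩ := hG
  exact ⟨A, c, hA, hc, fun s hs ↦ (hle s hs).trans (h s hs)⟩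

/-- Restriction to a smaller set. [folklore] -/
theorem growth_mono {D D' : Set ℂ} (hD : D ⊆ D') {F : ℂ → ℂ}
    (hF : ∃ A c : ℝ, 0 ≤ A ∧ 0 ≤ c ∧ ∀ s ∈ D', ‖F s‖ ≤ A * Real.exp (c * ‖s‖ ^ 2)) :
    ∃ A c : ℝ, 0 ≤ A ∧ 0 ≤ c ∧ ∀ s ∈ D, ‖F s‖ ≤ A * Real.exp (c * ‖s‖ ^ 2) := by
  obtain ⟨A, c, hA, hc, h⟩ := hF
  exact ⟨A, c, hA, hc, fun s hs ↦ h s (hD hs)⟩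

/-- Products. [folklore] -/
theorem growth_mul {D : Set ℂ} {F G : ℂ → ℂ}
    (hF : ∃ A c : ℝ, 0 ≤ A ∧ 0 ≤ c ∧ ∀ s ∈ D, ‖F s‖ ≤ A * Real.exp (c * ‖s‖ ^ 2))
    (hG : ∃ A c : ℝ, 0 ≤ A ∧ 0 ≤ c ∧ ∀ s ∈ D, ‖G s‖ ≤ A * Real.exp (c * ‖s‖ ^ 2)) :
    ∃ A c : ℝ, 0 ≤ A ∧ 0 ≤ c ∧ ∀ s ∈ D, ‖(F * G) s‖ ≤ A * Real.exp (c * ‖s‖ ^ 2) := by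
  obtain ⟨A, c, hA, hc, h⟩ := hF
  obtain ⟨A', c', hA', hc', h'⟩ := hG
  refine ⟨A * A', c + c', mul_nonneg hA hA', add_nonneg hc hc', fun s hs ↦ ?_⟩
  rw [Pi.mul_apply, norm_mul, add_mul, Real.exp_add]
  calc ‖F s‖ * ‖G s‖ ≤ (A * Real.exp (c * ‖s‖ ^ 2)) * (A' * Real.exp (c' * ‖s‖ ^ 2)) :=
        mul_le_mul (h s hs) (h' s hs) (norm_nonneg _) (mul_nonneg hA (Real.exp_pos _).le)
    _ = A * A' * (Real.exp (c * ‖s‖ ^ 2) * Real.exp (c' * ‖s‖ ^ 2)) := by ring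

/-- Sums. [folklore] -/
theorem growth_add {D : Set ℂ} {F G : ℂ → ℂ}
    (hF : ∃ A c : ℝ, 0 ≤ A ∧ 0 ≤ c ∧ ∀ s ∈ D, ‖F s‖ ≤ A * Real.exp (c * ‖s‖ ^ 2))
    (hG : ∃ A c : ℝ, 0 ≤ A ∧ 0 ≤ c ∧ ∀ s ∈ D, ‖G s‖ ≤ A * Real.exp (c * ‖s‖ ^ 2)) :
    ∃ A c : ℝ, 0 ≤ A ∧ 0 ≤ c ∧ ∀ s ∈ D, ‖(F + G) s‖ ≤ A * Real.exp (c * ‖s‖ ^ 2) := by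
  obtain ⟨A, c, hA, hc, h⟩ := hF
  obtain ⟨A', c', hA', hc', h'⟩ := hG
  refine ⟨A + A', max c c', add_nonneg hA hA', le_max_of_le_left hc, fun s hs ↦ ?_⟩
  rw [Pi.add_apply, add_mul]
  calc ‖F s + G s‖ ≤ ‖F s‖ + ‖G s‖ := norm_add_le _ _
    _ ≤ A * Real.exp (c * ‖s‖ ^ 2) + A' * Real.exp (c' * ‖s‖ ^ 2) := add_le_add (h s hs) (h' s hs)
    _ ≤ A * Real.exp (max c c' * ‖s‖ ^ 2) + A' * Real.exp (max c c' * ‖s‖ ^ 2) :=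
        add_le_add (mul_le_mul_of_nonneg_left (exp_mul_norm_sq_le_of_le (le_max_left _ _) s) hA)
          (mul_le_mul_of_nonneg_left (exp_mul_norm_sq_le_of_le (le_max_right _ _) s) hA')

/-- Differences. [folklore] -/
theorem growth_sub {D : Set ℂ} {F G : ℂ → ℂ}
    (hF : ∃ A c : ℝ, 0 ≤ A ∧ 0 ≤ c ∧ ∀ s ∈ D, ‖F s‖ ≤ A * Real.exp (c * ‖s‖ ^ 2))
    (hG : ∃ A c : ℝ, 0 ≤ A ∧ 0 ≤ c ∧ ∀ s ∈ D, ‖G s‖ ≤ A * Real.exp (c * ‖s‖ ^ 2)) :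
    ∃ A c : ℝ, 0 ≤ A ∧ 0 ≤ c ∧ ∀ s ∈ D, ‖(F - G) s‖ ≤ A * Real.exp (c * ‖s‖ ^ 2) := by
  have hG' : ∃ A c : ℝ, 0 ≤ A ∧ 0 ≤ c ∧ ∀ s ∈ D, ‖(-G) s‖ ≤ A * Real.exp (c * ‖s‖ ^ 2) :=
    growth_of_le (fun s _ ↦ by rw [Pi.neg_apply, norm_neg]) hG
  have := growth_add hF hG'
  rwa [← sub_eq_add_neg] at this

/-- Finite products. [folklore] -/
theorem growth_prod {ι : Type*} (S : Finset ι) {D : Set ℂ} {F : ι → ℂ → ℂ}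
    (hF : ∀ i ∈ S, ∃ A c : ℝ, 0 ≤ A ∧ 0 ≤ c ∧ ∀ s ∈ D, ‖F i s‖ ≤ A * Real.exp (c * ‖s‖ ^ 2)) :
    ∃ A c : ℝ, 0 ≤ A ∧ 0 ≤ c ∧ ∀ s ∈ D, ‖∏ i ∈ S, F i s‖ ≤ A * Real.exp (c * ‖s‖ ^ 2) := by
  classical
  induction S using Finset.induction_on with
  | empty => simpa using growth_const D 1
  | insert i S hi ih =>
    have h := growth_mul (hF i (Finset.mem_insert_self i S)) (ih fun j hj ↦ hF j (Finset.mem_insert_of_mem hj))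
    refine growth_of_le (fun s _ ↦ ?_) h
    rw [Finset.prod_insert hi, Pi.mul_apply]

/-- Finite sums. [folklore] -/
theorem growth_sum {ι : Type*} (S : Finset ι) {D : Set ℂ} {F : ι → ℂ → ℂ}
    (hF : ∀ i ∈ S, ∃ A c : ℝ, 0 ≤ A ∧ 0 ≤ c ∧ ∀ s ∈ D, ‖F i s‖ ≤ A * Real.exp (c * ‖s‖ ^ 2)) :
    ∃ A c : ℝ, 0 ≤ A ∧ 0 ≤ c ∧ ∀ s ∈ D, ‖∑ i ∈ S, F i s‖ ≤ A * Real.exp (c * ‖s‖ ^ 2) := by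
  classical
  induction S using Finset.induction_on with
  | empty => simpa using growth_const D 0
  | insert i S hi ih =>
    have h := growth_add (hF i (Finset.mem_insert_self i S)) (ih fun j hj ↦ hF j (Finset.mem_insert_of_mem hj))
    refine growth_of_le (fun s _ ↦ ?_) h
    rw [Finset.sum_insert hi, Pi.add_apply]

/-- The linear factor `s - 1`. [folklore] -/
theorem growth_sub_one (D : Set ℂ) :
    ∃ A c : ℝ, 0 ≤ A ∧ 0 ≤ c ∧ ∀ s ∈ D, ‖(fun s : ℂ ↦ s - 1) s‖ ≤ A * Real.exp (c * ‖s‖ ^ 2) := by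
  refine ⟨Real.exp 1, 1, (Real.exp_pos _).le, zero_le_one, fun s _ ↦ ?_⟩
  calc ‖s - 1‖ ≤ ‖s‖ + ‖(1 : ℂ)‖ := norm_sub_le _ _
    _ = ‖s‖ + 1 := by rw [norm_one]
    _ ≤ Real.exp 1 * Real.exp (1 * ‖s‖ ^ 2) := norm_add_one_le_exp s

/-- A real base `0 < b` to a power `e · s` with `|Re s| ≤ R`: bounded. [folklore] -/
theorem growth_cpow_const_mul {b : ℝ} (hb : 0 < b) (e : ℂ) (he : e.im = 0) {R : ℝ} :
    ∃ A c : ℝ, 0 ≤ A ∧ 0 ≤ c ∧ ∀ s ∈ {s : ℂ | |s.re| ≤ R},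
      ‖(fun s : ℂ ↦ (b : ℂ) ^ (e * s)) s‖ ≤ A * Real.exp (c * ‖s‖ ^ 2) := by
  refine ⟨max (b ^ (|e.re| * R)) (b ^ (-(|e.re| * R))), 0, le_max_of_le_left (Real.rpow_nonneg hb.le _), le_rfl,
    fun s hs ↦ ?_⟩
  have hs' : |s.re| ≤ R := hs
  rw [zero_mul, Real.exp_zero, mul_one, Complex.norm_cpow_eq_rpow_re_of_pos hb]
  have hre : (e * s).re = e.re * s.re := by rw [Complex.mul_re, he, zero_mul, sub_zero]
  rw [hre]
  have hbd : |e.re * s.re| ≤ |e.re| * R := by rw [abs_mul]; exact mul_le_mul_of_nonneg_left hs' (abs_nonneg _)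
  rcases le_or_gt 1 b with h1 | h1
  · exact le_max_of_le_left (Real.rpow_le_rpow_of_exponent_le h1 (le_abs_self _ |>.trans hbd))
  · refine le_max_of_le_right (Real.rpow_le_rpow_of_exponent_ge hb h1.le ?_)
    linarith [neg_abs_le (e.re * s.re)]

/-! ## The factors of the class representation on a vertical strip `|Re s| ≤ R` -/

/-- `𝔑^s` is bounded on vertical strips (`𝔑 ≥ 1`). [folklore] -/
theorem growth_natCast_cpow {N : ℕ} (hN : 0 < N) (R : ℝ) :
    ∃ A c : ℝ, 0 ≤ A ∧ 0 ≤ c ∧ ∀ s ∈ {s : ℂ | |s.re| ≤ R},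
      ‖(fun s : ℂ ↦ (N : ℂ) ^ s) s‖ ≤ A * Real.exp (c * ‖s‖ ^ 2) := by
  refine growth_of_le (fun s _ ↦ le_of_eq ?_) (growth_cpow_const_mul (b := (N : ℝ)) (by exact_mod_cast hN) 1 (by simp) (R := R))
  simp only [one_mul, Complex.ofReal_natCast]

/-- `Γ(e s)⁻¹` for real `e` has growth `exp(O(‖s‖²))` on vertical strips. [folklore] -/
theorem growth_inv_Gamma_const_mul (e : ℂ) (he : e.im = 0) {R : ℝ} (hR : 0 ≤ R) :
    ∃ A c : ℝ, 0 ≤ A ∧ 0 ≤ c ∧ ∀ s ∈ {s : ℂ | |s.re| ≤ R},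
      ‖(fun s : ℂ ↦ (Complex.Gamma (e * s))⁻¹) s‖ ≤ A * Real.exp (c * ‖s‖ ^ 2) := by
  obtain ⟨A, c, hA, hc, h⟩ := exists_norm_inv_Gamma_le_of_abs_re_le (S := |e.re| * R) (by positivity)
  refine ⟨A, c * ‖e‖ ^ 2, hA, by positivity, fun s hs ↦ ?_⟩
  have hs' : |s.re| ≤ R := hs
  have hre : |(e * s).re| ≤ |e.re| * R := by
    rw [Complex.mul_re, he, zero_mul, sub_zero, abs_mul]
    exact mul_le_mul_of_nonneg_left hs' (abs_nonneg _)
  calc ‖(Complex.Gamma (e * s))⁻¹‖ ≤ A * Real.exp (c * ‖e * s‖ ^ 2) := h _ hre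
    _ = A * Real.exp (c * ‖e‖ ^ 2 * ‖s‖ ^ 2) := by rw [norm_mul, mul_pow, mul_assoc]

/-- `Γ(e s + 1)⁻¹` for real `e` has growth `exp(O(‖s‖²))` on vertical strips. [folklore] -/
theorem growth_inv_Gamma_const_mul_add_one (e : ℂ) (he : e.im = 0) {R : ℝ} (hR : 0 ≤ R) :
    ∃ A c : ℝ, 0 ≤ A ∧ 0 ≤ c ∧ ∀ s ∈ {s : ℂ | |s.re| ≤ R},
      ‖(fun s : ℂ ↦ (Complex.Gamma (e * s + 1))⁻¹) s‖ ≤ A * Real.exp (c * ‖s‖ ^ 2) := by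
  obtain ⟨A, c, hA, hc, h⟩ := exists_norm_inv_Gamma_le_of_abs_re_le (S := |e.re| * R + 1) (by positivity)
  refine ⟨A * Real.exp (2 * c), 2 * c * ‖e‖ ^ 2, by positivity, by positivity, fun s hs ↦ ?_⟩
  have hs' : |s.re| ≤ R := hs
  have hre : |(e * s + 1).re| ≤ |e.re| * R + 1 := by
    rw [Complex.add_re, Complex.one_re, Complex.mul_re, he, zero_mul, sub_zero]
    calc |e.re * s.re + 1| ≤ |e.re * s.re| + |(1 : ℝ)| := abs_add_le _ _
      _ = |e.re| * |s.re| + 1 := by rw [abs_mul, abs_one]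
      _ ≤ |e.re| * R + 1 := by gcongr
  have hn : ‖e * s + 1‖ ^ 2 ≤ 2 + 2 * (‖e‖ ^ 2 * ‖s‖ ^ 2) := by
    have h1 : ‖e * s + 1‖ ≤ ‖e‖ * ‖s‖ + 1 := by
      calc ‖e * s + 1‖ ≤ ‖e * s‖ + ‖(1 : ℂ)‖ := norm_add_le _ _
        _ = ‖e‖ * ‖s‖ + 1 := by rw [norm_mul, norm_one]
    have h2 : ‖e * s + 1‖ ^ 2 ≤ (‖e‖ * ‖s‖ + 1) ^ 2 := pow_le_pow_left₀ (norm_nonneg _) h1 2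
    nlinarith [sq_nonneg (‖e‖ * ‖s‖ - 1), mul_pow ‖e‖ ‖s‖ 2]
  calc ‖(Complex.Gamma (e * s + 1))⁻¹‖ ≤ A * Real.exp (c * ‖e * s + 1‖ ^ 2) := h _ hre
    _ ≤ A * Real.exp (c * (2 + 2 * (‖e‖ ^ 2 * ‖s‖ ^ 2))) :=
        mul_le_mul_of_nonneg_left (Real.exp_le_exp.mpr (mul_le_mul_of_nonneg_left hn hc)) hA
    _ = A * Real.exp (2 * c) * Real.exp (2 * c * ‖e‖ ^ 2 * ‖s‖ ^ 2) := by
        rw [mul_assoc A, ← Real.exp_add]; congr 2; ring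

omit [NumberField K] in
/-- The factor `(π e_w)^{e_w s/2}` (as `(1/(π e_w))^{-(e_w (s/2))}`) is bounded on vertical strips.
[folklore] -/
theorem growth_piFactor (w : InfinitePlace K) (R : ℝ) :
    ∃ A c : ℝ, 0 ≤ A ∧ 0 ≤ c ∧ ∀ s ∈ {s : ℂ | |s.re| ≤ R},
      ‖(fun s : ℂ ↦ (((1 / (Real.pi * mult w) : ℝ)) : ℂ) ^ (-((mult w : ℂ) * (s / 2)))) s‖ ≤
        A * Real.exp (c * ‖s‖ ^ 2) := by
  have hpos : (0 : ℝ) < 1 / (Real.pi * mult w) := by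
    have : (0 : ℝ) < mult w := Nat.cast_pos.mpr mult_pos
    positivity
  refine growth_of_le (fun s _ ↦ le_of_eq ?_) (growth_cpow_const_mul hpos (-(mult w : ℂ) / 2) (by simp) (R := R))
  show ‖(((1 / (Real.pi * mult w) : ℝ)) : ℂ) ^ (-((mult w : ℂ) * (s / 2)))‖ =
    ‖(((1 / (Real.pi * mult w) : ℝ)) : ℂ) ^ (-(mult w : ℂ) / 2 * s)‖
  congr 2; ring

omit [NumberField K] in
/-- The factor `Γ(e_w s/2)⁻¹` has growth `exp(O(‖s‖²))` on vertical strips. [folklore] -/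
theorem growth_inv_Gamma_mult (w : InfinitePlace K) {R : ℝ} (hR : 0 ≤ R) :
    ∃ A c : ℝ, 0 ≤ A ∧ 0 ≤ c ∧ ∀ s ∈ {s : ℂ | |s.re| ≤ R},
      ‖(fun s : ℂ ↦ (Complex.Gamma ((mult w : ℂ) * (s / 2)))⁻¹) s‖ ≤ A * Real.exp (c * ‖s‖ ^ 2) := by
  refine growth_of_le (fun s _ ↦ le_of_eq ?_) (growth_inv_Gamma_const_mul ((mult w : ℂ) / 2) (by simp) hR)
  show ‖(Complex.Gamma ((mult w : ℂ) * (s / 2)))⁻¹‖ = ‖(Complex.Gamma ((mult w : ℂ) / 2 * s))⁻¹‖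
  congr 3; ring

omit [NumberField K] in
/-- The factor `Γ(e_w s/2 + 1)⁻¹` has growth `exp(O(‖s‖²))` on vertical strips. [folklore] -/
theorem growth_inv_Gamma_mult_add_one (w : InfinitePlace K) {R : ℝ} (hR : 0 ≤ R) :
    ∃ A c : ℝ, 0 ≤ A ∧ 0 ≤ c ∧ ∀ s ∈ {s : ℂ | |s.re| ≤ R},
      ‖(fun s : ℂ ↦ (Complex.Gamma ((mult w : ℂ) * (s / 2) + 1))⁻¹) s‖ ≤ A * Real.exp (c * ‖s‖ ^ 2) := by
  refine growth_of_le (fun s _ ↦ le_of_eq ?_) (growth_inv_Gamma_const_mul_add_one ((mult w : ℂ) / 2) (by simp) hR)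
  show ‖(Complex.Gamma ((mult w : ℂ) * (s / 2) + 1))⁻¹‖ = ‖(Complex.Gamma ((mult w : ℂ) / 2 * s + 1))⁻¹‖
  congr 3; ring

/-- **`A(s/2)⁻¹` on vertical strips**: `‖A(s/2)⁻¹‖ ≤ A exp(c‖s‖²)` for `|Re s| ≤ R`
(`A⁻¹ = ∏_w (π e_w)^{e_w s/2} Γ(e_w s/2)⁻¹`, `inv_gammaFactorC_eq`). [folklore] -/
theorem growth_inv_gammaFactorC {R : ℝ} (hR : 0 ≤ R) :
    ∃ A c : ℝ, 0 ≤ A ∧ 0 ≤ c ∧ ∀ s ∈ {s : ℂ | |s.re| ≤ R},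
      ‖(fun s : ℂ ↦ (gammaFactorC K (s / 2))⁻¹) s‖ ≤ A * Real.exp (c * ‖s‖ ^ 2) := by
  have key := growth_prod (Finset.univ : Finset (InfinitePlace K)) (D := {s : ℂ | |s.re| ≤ R})
    (F := fun w s ↦ (((1 / (Real.pi * mult w) : ℝ)) : ℂ) ^ (-((mult w : ℂ) * (s / 2))) *
      (Complex.Gamma ((mult w : ℂ) * (s / 2)))⁻¹)
    (fun w _ ↦ growth_mul (growth_piFactor w R) (growth_inv_Gamma_mult w hR))
  refine growth_of_le (fun s _ ↦ le_of_eq ?_) key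
  show ‖(gammaFactorC K (s / 2))⁻¹‖ = _
  rw [inv_gammaFactorC_eq]

open scoped Classical in
/-- **`E₀(s/2)` on vertical strips**: the entire correction `invGammaFactorC₀` has growth
`exp(O(‖s‖²))` for `|Re s| ≤ R`. [folklore] -/
theorem growth_invGammaFactorC₀ {R : ℝ} (hR : 0 ≤ R) :
    ∃ A c : ℝ, 0 ≤ A ∧ 0 ≤ c ∧ ∀ s ∈ {s : ℂ | |s.re| ≤ R},
      ‖(fun s : ℂ ↦ invGammaFactorC₀ K (s / 2)) s‖ ≤ A * Real.exp (c * ‖s‖ ^ 2) := by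
  have hprod := growth_prod (Finset.univ.erase (somePlace K)) (D := {s : ℂ | |s.re| ≤ R})
    (F := fun w s ↦ (((1 / (Real.pi * mult w) : ℝ)) : ℂ) ^ (-((mult w : ℂ) * (s / 2))) *
      (Complex.Gamma ((mult w : ℂ) * (s / 2)))⁻¹)
    (fun w _ ↦ growth_mul (growth_piFactor w R) (growth_inv_Gamma_mult w hR))
  have h2 := growth_const {s : ℂ | |s.re| ≤ R} (mult (somePlace K) : ℂ)
  have key := growth_mul hprod (growth_mul (growth_mul (growth_piFactor (somePlace K) R) h2)
    (growth_inv_Gamma_mult_add_one (somePlace K) hR))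
  refine growth_of_le (fun s _ ↦ le_of_eq ?_) key
  show ‖invGammaFactorC₀ K (s / 2)‖ = _
  rw [invGammaFactorC₀]
  rfl

/-- **`B(s)` on vertical strips.** [folklore] -/
theorem growth_classFrontFactor (C : ClassGroup (𝓞 K)) {R : ℝ} (hR : 0 ≤ R) :
    ∃ A c : ℝ, 0 ≤ A ∧ 0 ≤ c ∧ ∀ s ∈ {s : ℂ | |s.re| ≤ R},
      ‖(fun s : ℂ ↦ classFrontFactor K C s) s‖ ≤ A * Real.exp (c * ‖s‖ ^ 2) := by
  set D : Set ℂ := {s : ℂ | |s.re| ≤ R}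
  have key := growth_mul (growth_mul (growth_mul (growth_const D ((heckeCst K : ℂ))⁻¹)
    (growth_const D ((torsionOrder K : ℂ))⁻¹))
    (growth_natCast_cpow (Ideal.absNorm_pos_of_nonZeroDivisors (classRep K C)) R))
    (growth_inv_gammaFactorC (K := K) hR)
  refine growth_of_le (fun s _ ↦ le_of_eq ?_) key
  show ‖classFrontFactor K C s‖ = _
  rw [classFrontFactor]
  rfl

/-- **`B₀(s)` on vertical strips.** [folklore] -/
theorem growth_classFrontFactor₀ (C : ClassGroup (𝓞 K)) {R : ℝ} (hR : 0 ≤ R) :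
    ∃ A c : ℝ, 0 ≤ A ∧ 0 ≤ c ∧ ∀ s ∈ {s : ℂ | |s.re| ≤ R},
      ‖(fun s : ℂ ↦ classFrontFactor₀ K C s) s‖ ≤ A * Real.exp (c * ‖s‖ ^ 2) := by
  set D : Set ℂ := {s : ℂ | |s.re| ≤ R}
  have key := growth_mul (growth_mul (growth_mul (growth_const D ((heckeCst K : ℂ))⁻¹)
    (growth_const D ((torsionOrder K : ℂ))⁻¹))
    (growth_natCast_cpow (Ideal.absNorm_pos_of_nonZeroDivisors (classRep K C)) R))
    (growth_invGammaFactorC₀ (K := K) hR)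
  refine growth_of_le (fun s _ ↦ le_of_eq ?_) key
  show ‖classFrontFactor₀ K C s‖ = _
  rw [classFrontFactor₀]
  rfl

/-- **`Λ₀(s/2)` is bounded on vertical strips.** [folklore] -/
theorem growth_Λ₀_half (P : WeakFEPair ℂ) {R : ℝ} (hR : 0 ≤ R) :
    ∃ A c : ℝ, 0 ≤ A ∧ 0 ≤ c ∧ ∀ s ∈ {s : ℂ | |s.re| ≤ R},
      ‖(fun s : ℂ ↦ P.Λ₀ (s / 2)) s‖ ≤ A * Real.exp (c * ‖s‖ ^ 2) := by
  obtain ⟨M, hM, h⟩ := weakFEPair_exists_norm_Λ₀_le P (-R) R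
  refine ⟨M, 0, hM, le_rfl, fun s hs ↦ ?_⟩
  have hs' : |s.re| ≤ R := hs
  rw [zero_mul, Real.exp_zero, mul_one]
  have h2 : (s / 2).re = s.re / 2 := by simp
  refine h (s / 2) ?_ ?_
  · rw [h2]; linarith [neg_abs_le s.re]
  · rw [h2]; linarith [le_abs_self s.re]

/-- **The entire function `E(s) = ∑_C E_C(s)` (`= (s − 1) ζ_K(s)`) has growth `exp(O(‖s‖²))` on
every vertical strip `|Re s| ≤ R`** — from the explicit class representation
`E_C(s) = B(s)((s − 1)Λ₀(s/2) + 2ε) − (s − 1)B₀(s)` of `DedekindZetaClassSumCont.lean`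
(Neukirch VII (5.9)–(5.11)), the boundedness of `Λ₀` on vertical strips and the bound for `1/Γ`.
[folklore] -/
theorem growth_sum_classSumEntire (hinv : thetaIdeal_inv K) {R : ℝ} (hR : 0 ≤ R) :
    ∃ A c : ℝ, 0 ≤ A ∧ 0 ≤ c ∧ ∀ s ∈ {s : ℂ | |s.re| ≤ R},
      ‖∑ C : ClassGroup (𝓞 K), classSumEntire hinv C s‖ ≤ A * Real.exp (c * ‖s‖ ^ 2) := by
  set D : Set ℂ := {s : ℂ | |s.re| ≤ R} with hD
  refine growth_sum (Finset.univ : Finset (ClassGroup (𝓞 K))) (F := fun C s ↦ classSumEntire hinv C s)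
    fun C _ ↦ ?_
  have key := growth_sub
    (growth_mul (growth_classFrontFactor C hR)
      (growth_add (growth_mul (growth_sub_one D) (growth_Λ₀_half (classPair hinv C) hR))
        (growth_const D (2 * (classPair hinv C).ε))))
    (growth_mul (growth_sub_one D) (growth_classFrontFactor₀ C hR))
  refine growth_of_le (fun s _ ↦ le_of_eq ?_) key
  show ‖classSumEntire hinv C s‖ = _
  rw [classSumEntire]
  rfl

/-! ## Reflection: `1/Γ` on a left half-plane; `Γ` on a right half-plane -/

/-- **`Γ` on `Re w ≥ 1`**: `‖Γ(w)‖ ≤ exp(‖w‖²)` (`‖Γ(w)‖ ≤ Γ(Re w) ≤ (Re w)^{Re w}`, the tree's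
`norm_Gamma_le_Gamma_re` and `Real.Gamma_le_rpow_self`, and `log x ≤ x`). [folklore] -/
theorem norm_Gamma_le_exp_norm_sq {w : ℂ} (hw : 1 ≤ w.re) : ‖Complex.Gamma w‖ ≤ Real.exp (‖w‖ ^ 2) := by
  have h0 : 0 < w.re := by linarith
  have hre : w.re ≤ ‖w‖ := Complex.re_le_norm w
  calc ‖Complex.Gamma w‖ ≤ Real.Gamma w.re := Literature.NumberTheory.LFunctions.norm_Gamma_le_Gamma_re h0
    _ ≤ w.re ^ w.re := Literature.NumberTheory.LFunctions.Real.Gamma_le_rpow_self hw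
    _ = Real.exp (Real.log w.re * w.re) := by rw [Real.rpow_def_of_pos h0]
    _ ≤ Real.exp (‖w‖ ^ 2) := by
        refine Real.exp_le_exp.mpr ?_
        calc Real.log w.re * w.re ≤ w.re * w.re :=
              mul_le_mul_of_nonneg_right (Real.log_le_self h0.le) h0.le
          _ ≤ ‖w‖ * ‖w‖ := mul_le_mul hre hre h0.le (norm_nonneg _)
          _ = ‖w‖ ^ 2 := (sq _).symm

/-- **`1/Γ` on `Re z ≤ 0` by reflection**: `‖Γ(z)⁻¹‖ ≤ exp(‖1 − z‖²) exp(π‖z‖) / π`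
(`Γ(z)Γ(1 − z) = π / sin πz`, Mathlib `Complex.Gamma_mul_Gamma_one_sub`; `Γ(1 − z) ≠ 0` as
`Re(1 − z) ≥ 1`; when `sin πz = 0` Mathlib's `Γ(z)` is the junk value `0` and the bound is trivial).
[folklore] -/
theorem norm_inv_Gamma_le_of_re_nonpos {z : ℂ} (hz : z.re ≤ 0) :
    ‖(Complex.Gamma z)⁻¹‖ ≤ Real.exp (‖1 - z‖ ^ 2) * Real.exp (Real.pi * ‖z‖) / Real.pi := by
  have h1z : 1 ≤ (1 - z).re := by simp; linarith
  have hΓ1 : Complex.Gamma (1 - z) ≠ 0 := Complex.Gamma_ne_zero_of_re_pos (by linarith)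
  have hrefl := Complex.Gamma_mul_Gamma_one_sub z
  have hsin : ‖Complex.sin (Real.pi * z)‖ ≤ Real.exp (Real.pi * ‖z‖) := by
    refine (SelbergDirichlet.norm_sin_le_exp_norm _).trans (le_of_eq ?_)
    rw [norm_mul, Complex.norm_real, Real.norm_of_nonneg Real.pi_pos.le]
  have hrhs : 0 ≤ Real.exp (‖1 - z‖ ^ 2) * Real.exp (Real.pi * ‖z‖) / Real.pi := by positivity
  by_cases hs : Complex.sin (Real.pi * z) = 0
  · rw [hs, div_zero, mul_eq_zero] at hrefl
    rcases hrefl with h | h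
    · rw [h, inv_zero, norm_zero]; exact hrhs
    · exact absurd h hΓ1
  · have hπ : (Real.pi : ℂ) ≠ 0 := Complex.ofReal_ne_zero.mpr Real.pi_ne_zero
    have hone : Complex.Gamma z * (Complex.Gamma (1 - z) * Complex.sin (Real.pi * z) / Real.pi) = 1 := by
      rw [← mul_div_assoc, ← mul_assoc, hrefl]
      field_simp
    have hinv : (Complex.Gamma z)⁻¹ = Complex.Gamma (1 - z) * Complex.sin (Real.pi * z) / Real.pi :=
      inv_eq_of_mul_eq_one_right hone
    rw [hinv, norm_div, norm_mul, Complex.norm_real, Real.norm_of_nonneg Real.pi_pos.le]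
    gcongr
    · exact norm_Gamma_le_exp_norm_sq h1z

/-- `Γ(φ(s))⁻¹` with `Re φ(s) ≤ 0` and `‖φ(s)‖ ≤ ‖s‖` has growth `exp(O(‖s‖²))`. [folklore] -/
theorem growth_inv_Gamma_of_re_nonpos {D : Set ℂ} (φ : ℂ → ℂ) (hre : ∀ s ∈ D, (φ s).re ≤ 0)
    (hn : ∀ s ∈ D, ‖φ s‖ ≤ ‖s‖) :
    ∃ A c : ℝ, 0 ≤ A ∧ 0 ≤ c ∧ ∀ s ∈ D,
      ‖(fun s : ℂ ↦ (Complex.Gamma (φ s))⁻¹) s‖ ≤ A * Real.exp (c * ‖s‖ ^ 2) := by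
  refine ⟨Real.exp (2 + Real.pi) / Real.pi, 2 + Real.pi, by positivity, by positivity, fun s hs ↦ ?_⟩
  have h := norm_inv_Gamma_le_of_re_nonpos (hre s hs)
  have hz := hn s hs
  have h1 : ‖1 - φ s‖ ^ 2 ≤ 2 + 2 * ‖s‖ ^ 2 := by
    have : ‖1 - φ s‖ ≤ 1 + ‖s‖ := by
      calc ‖1 - φ s‖ ≤ ‖(1 : ℂ)‖ + ‖φ s‖ := norm_sub_le _ _
        _ ≤ 1 + ‖s‖ := by rw [norm_one]; linarith
    have h' : ‖1 - φ s‖ ^ 2 ≤ (1 + ‖s‖) ^ 2 := pow_le_pow_left₀ (norm_nonneg _) this 2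
    nlinarith [sq_nonneg (‖s‖ - 1)]
  have h2 : Real.pi * ‖φ s‖ ≤ Real.pi + Real.pi * ‖s‖ ^ 2 := by
    have := norm_le_one_add_norm_sq s
    nlinarith [Real.pi_pos, norm_nonneg (φ s)]
  calc ‖(Complex.Gamma (φ s))⁻¹‖ ≤ Real.exp (‖1 - φ s‖ ^ 2) * Real.exp (Real.pi * ‖φ s‖) / Real.pi := h
    _ ≤ Real.exp (2 + 2 * ‖s‖ ^ 2) * Real.exp (Real.pi + Real.pi * ‖s‖ ^ 2) / Real.pi := by
        gcongr
    _ = Real.exp (2 + Real.pi) / Real.pi * Real.exp ((2 + Real.pi) * ‖s‖ ^ 2) := by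
        rw [div_mul_eq_mul_div, ← Real.exp_add, ← Real.exp_add]
        congr 2; ring

/-- `Γ(φ(s))` with `Re φ(s) ≥ 1` and `‖φ(s)‖ ≤ 1 + ‖s‖` has growth `exp(O(‖s‖²))`. [folklore] -/
theorem growth_Gamma_of_one_le_re {D : Set ℂ} (φ : ℂ → ℂ) (hre : ∀ s ∈ D, 1 ≤ (φ s).re)
    (hn : ∀ s ∈ D, ‖φ s‖ ≤ 1 + ‖s‖) :
    ∃ A c : ℝ, 0 ≤ A ∧ 0 ≤ c ∧ ∀ s ∈ D,
      ‖(fun s : ℂ ↦ Complex.Gamma (φ s)) s‖ ≤ A * Real.exp (c * ‖s‖ ^ 2) := by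
  refine ⟨Real.exp 2, 2, by positivity, by positivity, fun s hs ↦ ?_⟩
  have h := norm_Gamma_le_exp_norm_sq (hre s hs)
  have h1 : ‖φ s‖ ^ 2 ≤ 2 + 2 * ‖s‖ ^ 2 := by
    have h' : ‖φ s‖ ^ 2 ≤ (1 + ‖s‖) ^ 2 := pow_le_pow_left₀ (norm_nonneg _) (hn s hs) 2
    nlinarith [sq_nonneg (‖s‖ - 1)]
  calc ‖Complex.Gamma (φ s)‖ ≤ Real.exp (‖φ s‖ ^ 2) := h
    _ ≤ Real.exp (2 + 2 * ‖s‖ ^ 2) := Real.exp_le_exp.mpr h1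
    _ = Real.exp 2 * Real.exp (2 * ‖s‖ ^ 2) := by rw [← Real.exp_add]

/-- A positive real base to a power of controlled size: `‖b^{φ(s)}‖ ≤ A exp(c‖s‖²)` when
`‖φ(s)‖ ≤ α‖s‖ + β`. [folklore] -/
theorem growth_cpow_of_norm_le {D : Set ℂ} {b : ℝ} (hb : 0 < b) (φ : ℂ → ℂ) {α β : ℝ} (hα : 0 ≤ α)
    (hφ : ∀ s ∈ D, ‖φ s‖ ≤ α * ‖s‖ + β) :
    ∃ A c : ℝ, 0 ≤ A ∧ 0 ≤ c ∧ ∀ s ∈ D,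
      ‖(fun s : ℂ ↦ (b : ℂ) ^ (φ s)) s‖ ≤ A * Real.exp (c * ‖s‖ ^ 2) := by
  set L : ℝ := |Real.log b| with hL
  refine ⟨Real.exp (L * β) * Real.exp (L * α), L * α, by positivity, by positivity, fun s hs ↦ ?_⟩
  show ‖(b : ℂ) ^ (φ s)‖ ≤ _
  rw [Complex.norm_cpow_eq_rpow_re_of_pos hb, Real.rpow_def_of_pos hb]
  have h1 : Real.log b * (φ s).re ≤ L * (α * ‖s‖ + β) := by
    calc Real.log b * (φ s).re ≤ |Real.log b * (φ s).re| := le_abs_self _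
      _ = L * |(φ s).re| := by rw [abs_mul, hL]
      _ ≤ L * ‖φ s‖ := mul_le_mul_of_nonneg_left (Complex.abs_re_le_norm _) (abs_nonneg _)
      _ ≤ L * (α * ‖s‖ + β) := mul_le_mul_of_nonneg_left (hφ s hs) (abs_nonneg _)
  have h2 := exp_mul_norm_le (c := L * α) (by positivity) s
  calc Real.exp (Real.log b * (φ s).re) ≤ Real.exp (L * (α * ‖s‖ + β)) := Real.exp_le_exp.mpr h1
    _ = Real.exp (L * β) * Real.exp (L * α * ‖s‖) := by rw [← Real.exp_add]; congr 1; ring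
    _ ≤ Real.exp (L * β) * (Real.exp (L * α) * Real.exp (L * α * ‖s‖ ^ 2)) :=
        mul_le_mul_of_nonneg_left h2 (Real.exp_pos _).le
    _ = Real.exp (L * β) * Real.exp (L * α) * Real.exp (L * α * ‖s‖ ^ 2) := by ring

/-- Powers. [folklore] -/
theorem growth_pow {D : Set ℂ} {F : ℂ → ℂ} (n : ℕ)
    (hF : ∃ A c : ℝ, 0 ≤ A ∧ 0 ≤ c ∧ ∀ s ∈ D, ‖F s‖ ≤ A * Real.exp (c * ‖s‖ ^ 2)) :
    ∃ A c : ℝ, 0 ≤ A ∧ 0 ≤ c ∧ ∀ s ∈ D, ‖(fun s ↦ F s ^ n) s‖ ≤ A * Real.exp (c * ‖s‖ ^ 2) := by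
  induction n with
  | zero => simpa using growth_const D 1
  | succ n ih =>
    refine growth_of_le (fun s _ ↦ le_of_eq ?_) (growth_mul ih hF)
    simp only [Pi.mul_apply, pow_succ]

/-! ## Region I: the half-plane of absolute convergence -/

/-- **`ζ_K` is bounded on `Re s ≥ 2`**: `‖ζ_K(s)‖ ≤ ∑ a_n n^{-2}` (`ζ_K = ∑ a_n n^{-s}` there,
`isDedekindZetaContinuation_dedekindZetaCont_holds`; termwise `|a_n n^{-s}| ≤ a_n n^{-2}`). [folklore] -/
theorem exists_norm_dedekindZetaCont_le_of_two_le_re :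
    ∃ Z : ℝ, 0 ≤ Z ∧ ∀ s : ℂ, 2 ≤ s.re → ‖dedekindZetaCont K s‖ ≤ Z := by
  set a : ℕ → ℂ := fun n ↦ ((Nat.card {I : Ideal (𝓞 K) // Ideal.absNorm I = n} : ℕ) : ℂ) with ha
  have hsum2 : Summable fun n ↦ ‖LSeries.term a 2 n‖ :=
    summable_norm_iff.mpr (LSeriesSummable_dedekindZeta (K := K) (s := 2) (by simp))
  refine ⟨∑' n, ‖LSeries.term a 2 n‖, tsum_nonneg fun n ↦ norm_nonneg _, fun s hs ↦ ?_⟩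
  have hs1 : 1 < s.re := by linarith
  have hsum : Summable fun n ↦ ‖LSeries.term a s n‖ :=
    summable_norm_iff.mpr (LSeriesSummable_dedekindZeta (K := K) hs1)
  rw [(isDedekindZetaContinuation_dedekindZetaCont_holds K).eqOn hs1]
  show ‖LSeries a s‖ ≤ _
  calc ‖LSeries a s‖ ≤ ∑' n, ‖LSeries.term a s n‖ := norm_tsum_le_tsum_norm hsum
    _ ≤ ∑' n, ‖LSeries.term a 2 n‖ :=
        hsum.tsum_le_tsum (fun n ↦ LSeries.norm_term_le_of_re_le_re a (by simpa using hs) n) hsum2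


/-! ## Region III: the left half-plane, by the functional equation -/

/-- Powers of `2π` of controlled size. [folklore] -/
theorem growth_two_pi_cpow {D : Set ℂ} (φ : ℂ → ℂ) {α β : ℝ} (hα : 0 ≤ α)
    (hφ : ∀ s ∈ D, ‖φ s‖ ≤ α * ‖s‖ + β) :
    ∃ A c : ℝ, 0 ≤ A ∧ 0 ≤ c ∧ ∀ s ∈ D,
      ‖(fun s : ℂ ↦ (2 * (Real.pi : ℂ)) ^ (φ s)) s‖ ≤ A * Real.exp (c * ‖s‖ ^ 2) := by
  refine growth_of_le (fun s _ ↦ le_of_eq ?_) (growth_cpow_of_norm_le (b := 2 * Real.pi) (by positivity) φ hα hφ)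
  show ‖(2 * (Real.pi : ℂ)) ^ (φ s)‖ = ‖((2 * Real.pi : ℝ) : ℂ) ^ (φ s)‖
  push_cast
  rfl

/-- **`γ_K(s) ≠ 0` off the integers** (the poles of `Γ(s/2)`, `Γ(s)` — zeros of Mathlib's `Gamma` —
are at integers). [folklore] -/
theorem dedekindGammaFactor_ne_zero {s : ℂ} (hs : ∀ n : ℤ, s ≠ n) : dedekindGammaFactor K s ≠ 0 := by
  unfold dedekindGammaFactor
  refine mul_ne_zero (mul_ne_zero ?_ (pow_ne_zero _ ?_)) (pow_ne_zero _ ?_)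
  · rw [Ne, Complex.cpow_eq_zero_iff, not_and_or]
    left
    exact_mod_cast (Int.natAbs_pos.mpr (discr_ne_zero K)).ne'
  · rw [Ne, Complex.Gammaℝ_eq_zero_iff]
    rintro ⟨n, hn⟩
    exact hs (-(2 * n)) (by rw [hn]; push_cast; ring)
  · rw [Complex.Gammaℂ_def]
    refine mul_ne_zero (mul_ne_zero two_ne_zero ?_) (Complex.Gamma_ne_zero fun m hm ↦ hs (-m) ?_)
    · rw [Ne, Complex.cpow_eq_zero_iff, not_and_or]
      left
      exact mul_ne_zero two_ne_zero (Complex.ofReal_ne_zero.mpr Real.pi_ne_zero)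
    · rw [hm]; push_cast; ring

/-- **`ζ_K(s)` for `Re s ≤ −1`, `s ∉ ℤ`, has growth `exp(O(‖s‖²))`** — from the functional equation
`Λ_K(1 − s) = Λ_K(s)`: `ζ_K(s) = γ_K(s)⁻¹ γ_K(1 − s) ζ_K(1 − s)` with `‖ζ_K(1 − s)‖ ≤ ζ_K(2)`-type
bound (Region I), `‖Γ(w)‖ ≤ Γ(Re w) ≤ exp(‖w‖²)` for the gamma factors of `1 − s`, and the reflection
formula for `Γ(s/2)⁻¹`, `Γ(s)⁻¹` (the shape of Titchmarsh's proof of (2.12.3) for `ζ`). [folklore] -/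
theorem growth_dedekindZetaCont_of_re_le_neg_one (hFE : completedDedekindZeta_one_sub (K := K)) :
    ∃ A c : ℝ, 0 ≤ A ∧ 0 ≤ c ∧ ∀ s ∈ {s : ℂ | s.re ≤ -1 ∧ ∀ n : ℤ, s ≠ n},
      ‖(fun s : ℂ ↦ dedekindZetaCont K s) s‖ ≤ A * Real.exp (c * ‖s‖ ^ 2) := by
  set D : Set ℂ := {s : ℂ | s.re ≤ -1 ∧ ∀ n : ℤ, s ≠ n} with hD
  obtain ⟨Z, hZ0, hZ⟩ := exists_norm_dedekindZetaCont_le_of_two_le_re (K := K)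
  set dR : ℝ := ((discr K).natAbs : ℝ) with hdR
  have hdpos : 0 < dR := by rw [hdR]; exact_mod_cast Int.natAbs_pos.mpr (discr_ne_zero K)
  -- norm bounds for the exponents
  have hn1 : ∀ s ∈ D, ‖-(s / 2)‖ ≤ 1 / 2 * ‖s‖ + 0 := fun s _ ↦ by
    rw [norm_neg, norm_div, Complex.norm_two]; linarith
  have hn2 : ∀ s ∈ D, ‖-(-s / 2)‖ ≤ 1 / 2 * ‖s‖ + 0 := fun s _ ↦ by
    rw [norm_neg, norm_div, norm_neg, Complex.norm_two]; linarith
  have hn3 : ∀ s ∈ D, ‖-(-s)‖ ≤ 1 * ‖s‖ + 0 := fun s _ ↦ by rw [neg_neg]; linarith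
  have h1s : ∀ s : ℂ, ‖1 - s‖ ≤ 1 + ‖s‖ := fun s ↦ by
    calc ‖1 - s‖ ≤ ‖(1 : ℂ)‖ + ‖s‖ := norm_sub_le _ _
      _ = 1 + ‖s‖ := by rw [norm_one]
  have hn4 : ∀ s ∈ D, ‖(1 - s) / 2‖ ≤ 1 / 2 * ‖s‖ + 1 / 2 := fun s _ ↦ by
    rw [norm_div, Complex.norm_two]; linarith [h1s s]
  have hn5 : ∀ s ∈ D, ‖-(1 - s) / 2‖ ≤ 1 / 2 * ‖s‖ + 1 / 2 := fun s _ ↦ by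
    rw [norm_div, norm_neg, Complex.norm_two]; linarith [h1s s]
  have hn6 : ∀ s ∈ D, ‖-(1 - s)‖ ≤ 1 * ‖s‖ + 1 := fun s _ ↦ by rw [norm_neg]; linarith [h1s s]
  -- the factors of `γ(s)⁻¹`
  have g1 : ∃ A c : ℝ, 0 ≤ A ∧ 0 ≤ c ∧ ∀ s ∈ D,
      ‖(fun s : ℂ ↦ (((discr K).natAbs : ℂ) ^ (s / 2))⁻¹) s‖ ≤ A * Real.exp (c * ‖s‖ ^ 2) := by
    refine growth_of_le (fun s _ ↦ le_of_eq ?_)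
      (growth_cpow_of_norm_le (b := dR) hdpos (fun s ↦ -(s / 2)) (by norm_num) hn1)
    show ‖(((discr K).natAbs : ℂ) ^ (s / 2))⁻¹‖ = ‖((dR : ℝ) : ℂ) ^ (-(s / 2))‖
    rw [Complex.cpow_neg, hdR, Complex.ofReal_natCast]
  have g2 : ∃ A c : ℝ, 0 ≤ A ∧ 0 ≤ c ∧ ∀ s ∈ D,
      ‖(fun s : ℂ ↦ (Gammaℝ s)⁻¹) s‖ ≤ A * Real.exp (c * ‖s‖ ^ 2) := by
    refine growth_of_le (fun s _ ↦ le_of_eq ?_)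
      (growth_mul (growth_cpow_of_norm_le Real.pi_pos (fun s ↦ -(-s / 2)) (by norm_num) hn2)
        (growth_inv_Gamma_of_re_nonpos (fun s ↦ s / 2) (fun s hs ↦ by simp; linarith [hs.1])
          (fun s _ ↦ by rw [norm_div, Complex.norm_two]; linarith [norm_nonneg s])))
    show ‖(Gammaℝ s)⁻¹‖ = ‖(Real.pi : ℂ) ^ (-(-s / 2)) * (Complex.Gamma (s / 2))⁻¹‖
    rw [Complex.Gammaℝ_def, mul_inv, ← Complex.cpow_neg]
  have g3 : ∃ A c : ℝ, 0 ≤ A ∧ 0 ≤ c ∧ ∀ s ∈ D,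
      ‖(fun s : ℂ ↦ (Gammaℂ s)⁻¹) s‖ ≤ A * Real.exp (c * ‖s‖ ^ 2) := by
    refine growth_of_le (fun s _ ↦ le_of_eq ?_)
      (growth_mul (growth_mul (growth_const D (2 : ℂ)⁻¹) (growth_two_pi_cpow (fun s ↦ -(-s)) zero_le_one hn3))
        (growth_inv_Gamma_of_re_nonpos (fun s ↦ s) (fun s hs ↦ by linarith [hs.1]) (fun s _ ↦ le_rfl)))
    show ‖(Gammaℂ s)⁻¹‖ = ‖(2 : ℂ)⁻¹ * (2 * (Real.pi : ℂ)) ^ (-(-s)) * (Complex.Gamma s)⁻¹‖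
    rw [Complex.Gammaℂ_def, mul_inv, mul_inv, ← Complex.cpow_neg]
  -- the factors of `γ(1 - s)`
  have g4 : ∃ A c : ℝ, 0 ≤ A ∧ 0 ≤ c ∧ ∀ s ∈ D,
      ‖(fun s : ℂ ↦ ((discr K).natAbs : ℂ) ^ ((1 - s) / 2)) s‖ ≤ A * Real.exp (c * ‖s‖ ^ 2) := by
    refine growth_of_le (fun s _ ↦ le_of_eq ?_)
      (growth_cpow_of_norm_le (b := dR) hdpos (fun s ↦ (1 - s) / 2) (by norm_num) hn4)
    show ‖((discr K).natAbs : ℂ) ^ ((1 - s) / 2)‖ = ‖((dR : ℝ) : ℂ) ^ ((1 - s) / 2)‖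
    rw [hdR, Complex.ofReal_natCast]
  have g5 : ∃ A c : ℝ, 0 ≤ A ∧ 0 ≤ c ∧ ∀ s ∈ D,
      ‖(fun s : ℂ ↦ Gammaℝ (1 - s)) s‖ ≤ A * Real.exp (c * ‖s‖ ^ 2) := by
    refine growth_of_le (fun s _ ↦ le_of_eq ?_)
      (growth_mul (growth_cpow_of_norm_le Real.pi_pos (fun s ↦ -(1 - s) / 2) (by norm_num) hn5)
        (growth_Gamma_of_one_le_re (fun s ↦ (1 - s) / 2) (fun s hs ↦ by simp; linarith [hs.1])
          (fun s _ ↦ by rw [norm_div, Complex.norm_two]; linarith [h1s s, norm_nonneg s])))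
    show ‖Gammaℝ (1 - s)‖ = ‖(Real.pi : ℂ) ^ (-(1 - s) / 2) * Complex.Gamma ((1 - s) / 2)‖
    rw [Complex.Gammaℝ_def]
  have g6 : ∃ A c : ℝ, 0 ≤ A ∧ 0 ≤ c ∧ ∀ s ∈ D,
      ‖(fun s : ℂ ↦ Gammaℂ (1 - s)) s‖ ≤ A * Real.exp (c * ‖s‖ ^ 2) := by
    refine growth_of_le (fun s _ ↦ le_of_eq ?_)
      (growth_mul (growth_mul (growth_const D (2 : ℂ)) (growth_two_pi_cpow (fun s ↦ -(1 - s)) zero_le_one hn6))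
        (growth_Gamma_of_one_le_re (fun s ↦ 1 - s) (fun s hs ↦ by simp; linarith [hs.1])
          (fun s _ ↦ h1s s)))
    show ‖Gammaℂ (1 - s)‖ = ‖(2 : ℂ) * (2 * (Real.pi : ℂ)) ^ (-(1 - s)) * Complex.Gamma (1 - s)‖
    rw [Complex.Gammaℂ_def]
  have g7 : ∃ A c : ℝ, 0 ≤ A ∧ 0 ≤ c ∧ ∀ s ∈ D,
      ‖(fun s : ℂ ↦ dedekindZetaCont K (1 - s)) s‖ ≤ A * Real.exp (c * ‖s‖ ^ 2) :=
    ⟨Z, 0, hZ0, le_rfl, fun s hs ↦ by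
      rw [zero_mul, Real.exp_zero, mul_one]
      exact hZ (1 - s) (by simp; linarith [hs.1])⟩
  -- assembly
  have key := growth_mul (growth_mul (growth_mul g1 (growth_pow (nrRealPlaces K) g2)) (growth_pow (nrComplexPlaces K) g3))
    (growth_mul (growth_mul (growth_mul g4 (growth_pow (nrRealPlaces K) g5)) (growth_pow (nrComplexPlaces K) g6)) g7)
  refine growth_of_le (fun s hs ↦ le_of_eq ?_) key
  have hγ : dedekindGammaFactor K s ≠ 0 := dedekindGammaFactor_ne_zero hs.2
  have hfe : dedekindGammaFactor K (1 - s) * dedekindZetaCont K (1 - s) =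
      dedekindGammaFactor K s * dedekindZetaCont K s := hFE hs.2
  have hζ : dedekindZetaCont K s =
      (dedekindGammaFactor K s)⁻¹ * (dedekindGammaFactor K (1 - s) * dedekindZetaCont K (1 - s)) := by
    rw [eq_inv_mul_iff_mul_eq₀ hγ, hfe]
  show ‖dedekindZetaCont K s‖ = _
  rw [hζ]
  unfold dedekindGammaFactor
  rw [mul_inv, mul_inv, ← inv_pow, ← inv_pow]
  rfl

/-- **`(s − 1) ζ_K(s)` on `Re s ≤ −1`, `s ∉ ℤ`.** [folklore] -/
theorem growth_sub_one_mul_dedekindZetaCont_of_re_le_neg_one (hFE : completedDedekindZeta_one_sub (K := K)) :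
    ∃ A c : ℝ, 0 ≤ A ∧ 0 ≤ c ∧ ∀ s ∈ {s : ℂ | s.re ≤ -1 ∧ ∀ n : ℤ, s ≠ n},
      ‖(fun s : ℂ ↦ (s - 1) * dedekindZetaCont K s) s‖ ≤ A * Real.exp (c * ‖s‖ ^ 2) :=
  growth_mul (growth_sub_one _) (growth_dedekindZetaCont_of_re_le_neg_one hFE)

/-- **Region III including the integer points** (`s = m ≤ −1`): the bound extends from `s ∉ ℤ` by
continuity of the entire function `E(s) = ∑_C E_C(s) = (s − 1) ζ_K(s)` along `m + i/k → m`. [folklore] -/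
theorem exists_bound_sub_one_mul_dedekindZetaCont_of_re_le_neg_one (hinv : thetaIdeal_inv K)
    (hFE : completedDedekindZeta_one_sub (K := K)) :
    ∃ A c : ℝ, 0 ≤ A ∧ 0 ≤ c ∧ ∀ s : ℂ, s.re ≤ -1 →
      ‖(s - 1) * dedekindZetaCont K s‖ ≤ A * Real.exp (c * ‖s‖ ^ 2) := by
  obtain ⟨A, c, hA, hc, h⟩ := growth_sub_one_mul_dedekindZetaCont_of_re_le_neg_one (K := K) hFE
  refine ⟨A, c, hA, hc, fun s hs ↦ ?_⟩
  by_cases hint : ∃ n : ℤ, s = n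
  · obtain ⟨n, rfl⟩ := hint
    have hn1 : (n : ℂ) ≠ 1 := by
      intro h1
      have : (n : ℂ).re = 1 := by rw [h1, Complex.one_re]
      simp at this hs
      rw [this] at hs; norm_num at hs
    set E : ℂ → ℂ := fun s ↦ ∑ C : ClassGroup (𝓞 K), classSumEntire hinv C s with hE
    have hEcont : Continuous E := (Differentiable.fun_sum fun C _ ↦ differentiable_classSumEntire hinv C).continuous
    -- the sequence `u_k = n + i/(k+1)`
    set u : ℕ → ℂ := fun k ↦ (n : ℂ) + ((1 / ((k : ℝ) + 1) : ℝ) : ℂ) * I with hu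
    have hu_tend : Tendsto u atTop (𝓝 (n : ℂ)) := by
      have h0 : Tendsto (fun k : ℕ ↦ ((1 / ((k : ℝ) + 1) : ℝ) : ℂ) * I) atTop (𝓝 (((0 : ℝ) : ℂ) * I)) :=
        ((Complex.continuous_ofReal.tendsto _).comp tendsto_one_div_add_atTop_nhds_zero_nat).mul_const I
      have := h0.const_add (n : ℂ)
      simpa [hu] using this
    have hu_mem : ∀ k, u k ∈ {s : ℂ | s.re ≤ -1 ∧ ∀ m : ℤ, s ≠ m} := by
      intro k
      have him : (u k).im = 1 / ((k : ℝ) + 1) := by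
        simp only [hu, Complex.add_im, Complex.intCast_im, Complex.mul_im, Complex.ofReal_re,
          Complex.ofReal_im, Complex.I_re, Complex.I_im, mul_zero, mul_one, zero_add, add_zero]
      have hre : (u k).re = n := by
        simp only [hu, Complex.add_re, Complex.intCast_re, Complex.mul_re, Complex.ofReal_re,
          Complex.ofReal_im, Complex.I_re, Complex.I_im, mul_zero, mul_one, sub_zero, add_zero]
      refine ⟨by rw [hre]; simpa using hs, fun m hm ↦ ?_⟩
      have : (u k).im = 0 := by rw [hm]; simp
      rw [him] at this
      have hpos : (0 : ℝ) < 1 / ((k : ℝ) + 1) := by positivity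
      linarith
    have hu1 : ∀ k, u k ≠ 1 := fun k h1 ↦ by
      have := (hu_mem k).2 1
      push_cast at this
      exact this h1
    -- pass to the limit
    have hlim1 : Tendsto (fun k ↦ ‖E (u k)‖) atTop (𝓝 ‖E n‖) :=
      ((hEcont.tendsto _).comp hu_tend).norm
    have hlim2 : Tendsto (fun k ↦ A * Real.exp (c * ‖u k‖ ^ 2)) atTop (𝓝 (A * Real.exp (c * ‖(n : ℂ)‖ ^ 2))) := by
      have hcts : Continuous fun s : ℂ ↦ A * Real.exp (c * ‖s‖ ^ 2) := by fun_prop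
      exact (hcts.tendsto _).comp hu_tend
    have hle : ∀ k, ‖E (u k)‖ ≤ A * Real.exp (c * ‖u k‖ ^ 2) := by
      intro k
      show ‖∑ C : ClassGroup (𝓞 K), classSumEntire hinv C (u k)‖ ≤ _
      rw [← sub_one_mul_dedekindZetaCont_eq_sum_classSumEntire hinv (hu1 k)]
      exact h (u k) (hu_mem k)
    have key : ‖E n‖ ≤ A * Real.exp (c * ‖(n : ℂ)‖ ^ 2) := le_of_tendsto_of_tendsto' hlim1 hlim2 hle
    have key' : ‖∑ C : ClassGroup (𝓞 K), classSumEntire hinv C n‖ ≤ A * Real.exp (c * ‖(n : ℂ)‖ ^ 2) := key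
    rwa [← sub_one_mul_dedekindZetaCont_eq_sum_classSumEntire hinv hn1] at key'
  · push Not at hint
    exact h s ⟨hs, hint⟩

/-! ## Assembly: `(s − 1) ζ_K(s)` has finite order -/

/-- `c x² ≤ x³ + c³` for `x, c ≥ 0`. [folklore] -/
theorem mul_sq_le_cube_add {c x : ℝ} (hc : 0 ≤ c) (hx : 0 ≤ x) : c * x ^ 2 ≤ x ^ 3 + c ^ 3 := by
  rcases le_or_gt x c with h | h
  · nlinarith [mul_le_mul h h hx hc, pow_nonneg hx 3]
  · nlinarith [sq_nonneg x, pow_nonneg hc 3]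

/-- **Finite order of `(s − 1) ζ_K(s)` from the functional equation** (Selberg's axiom (ii) for `ζ_K`;
Kaczorowski 2006, §2.1 Example 3; the proof follows the three-region shape of Titchmarsh's proof of
(2.12.3)): `‖(s − 1) ζ_K(s)‖ ≤ A exp(‖s‖³)` for `s ≠ 1` — on `Re s ≥ 2` by the Dirichlet series, on
`|Re s| ≤ 2` by the class representation (`growth_sum_classSumEntire`, with the theta transformation
formula `thetaIdeal_inv_holds`), on `Re s ≤ −1` by the functional equation.
[cite: KaczorowskiSelbergClass2006, §2.1 axiom (2) and Example 3] -/
theorem dedekindZetaCont_finiteOrder_of_completedDedekindZeta_one_sub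
    (hFE : completedDedekindZeta_one_sub (K := K)) : dedekindZetaCont_finiteOrder K := by
  have hinv := thetaIdeal_inv_holds K
  obtain ⟨Z, hZ0, hZ⟩ := exists_norm_dedekindZetaCont_le_of_two_le_re (K := K)
  obtain ⟨A₂, c₂, hA₂, hc₂, h₂⟩ := growth_sum_classSumEntire (K := K) hinv (R := 2) (by norm_num)
  obtain ⟨A₃, c₃, hA₃, hc₃, h₃⟩ := exists_bound_sub_one_mul_dedekindZetaCont_of_re_le_neg_one (K := K) hinv hFE
  set A : ℝ := Z * Real.exp 1 + A₂ + A₃ with hAdef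
  set c : ℝ := max 1 (max c₂ c₃) with hcdef
  have hA : 0 ≤ A := by positivity
  have hc0 : 0 ≤ c := le_max_of_le_left zero_le_one
  -- the uniform bound `A exp(c ‖s‖²)`
  have main : ∀ s : ℂ, s ≠ 1 → ‖(s - 1) * dedekindZetaCont K s‖ ≤ A * Real.exp (c * ‖s‖ ^ 2) := by
    intro s hs1
    have hec : ∀ {c' : ℝ}, c' ≤ c → Real.exp (c' * ‖s‖ ^ 2) ≤ Real.exp (c * ‖s‖ ^ 2) :=
      fun h ↦ exp_mul_norm_sq_le_of_le h s
    rcases le_or_gt 2 s.re with hI | hI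
    · -- Region I
      calc ‖(s - 1) * dedekindZetaCont K s‖ = ‖s - 1‖ * ‖dedekindZetaCont K s‖ := norm_mul _ _
        _ ≤ (Real.exp 1 * Real.exp (1 * ‖s‖ ^ 2)) * Z := by
            refine mul_le_mul ?_ (hZ s hI) (norm_nonneg _) (by positivity)
            calc ‖s - 1‖ ≤ ‖s‖ + ‖(1 : ℂ)‖ := norm_sub_le _ _
              _ = ‖s‖ + 1 := by rw [norm_one]
              _ ≤ _ := norm_add_one_le_exp s
        _ = Z * Real.exp 1 * Real.exp (1 * ‖s‖ ^ 2) := by ring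
        _ ≤ A * Real.exp (c * ‖s‖ ^ 2) :=
            mul_le_mul (by rw [hAdef]; linarith) (hec (le_max_left _ _)) (Real.exp_pos _).le hA
    rcases le_or_gt s.re (-1) with hIII | hIII
    · -- Region III
      calc ‖(s - 1) * dedekindZetaCont K s‖ ≤ A₃ * Real.exp (c₃ * ‖s‖ ^ 2) := h₃ s hIII
        _ ≤ A * Real.exp (c * ‖s‖ ^ 2) :=
            mul_le_mul (by rw [hAdef]; linarith [mul_nonneg hZ0 (Real.exp_pos 1).le])
              (hec ((le_max_right _ _).trans (le_max_right _ _))) (Real.exp_pos _).le hA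
    · -- Region II
      have hstrip : s ∈ {s : ℂ | |s.re| ≤ 2} := by
        show |s.re| ≤ 2
        rw [abs_le]; constructor <;> linarith
      calc ‖(s - 1) * dedekindZetaCont K s‖ = ‖∑ C : ClassGroup (𝓞 K), classSumEntire hinv C s‖ := by
            rw [sub_one_mul_dedekindZetaCont_eq_sum_classSumEntire hinv hs1]
        _ ≤ A₂ * Real.exp (c₂ * ‖s‖ ^ 2) := h₂ s hstrip
        _ ≤ A * Real.exp (c * ‖s‖ ^ 2) :=
            mul_le_mul (by rw [hAdef]; linarith [mul_nonneg hZ0 (Real.exp_pos 1).le])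
              (hec ((le_max_left _ _).trans (le_max_right _ _))) (Real.exp_pos _).le hA
  refine ⟨A * Real.exp (c ^ 3), 3, fun s hs ↦ (main s hs).trans ?_⟩
  rw [mul_assoc, ← Real.exp_add, show (3 : ℝ) = ((3 : ℕ) : ℝ) by norm_num, Real.rpow_natCast]
  exact mul_le_mul_of_nonneg_left (Real.exp_le_exp.mpr (by linarith [mul_sq_le_cube_add hc0 (norm_nonneg s)])) hA


end Literature.NumberTheory.LFunctions.NumberField

end
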